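import Summits.AtomisticToContinuum.FouriersLaw.Theorems.PhononMeanFreePathIncoherentChannelLightConeReduction
import Summits.AtomisticToContinuum.FouriersLaw.Theorems.PhononMeanFreePathIncoherentChannelCommonPastBound

/-!
# The `N`-uniform `L²(dt)` budget of the common-past term from the left-sensitivity budget
# (line `two-horizons-forecast-loss`, crux `IncoherentChannel`, stub `commonPast_sq_integral_le_of_leftBudget`)

Helper file of line `two-horizons-forecast-loss` of crux `PhononMeanFreePath.IncoherentChannel`
(stmt-AtomisticToContinuum-11811), registered stub `commonPast_sq_integral_le_of_leftBudget`.

Setting (`Theorems/PhononMeanFreePathDefs`): `P = pinnedChain ω₂ lam β γ`, the `(N+1)`-site pinned anharmonic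
chain with both Langevin baths at `T > 0`, `μ₀ = P.gibbsMeasure (N+1) T`, `ν = gaussianReal 0 T`,
`v_t = fcast … N t = K_t p_N` (mean forecast of the far momentum) and the common-past term
`P_N(t) = commonPast … N t = Cov_{μ₀}(p_0², v_t²)`. With the LEFT-SENSITIVITY (propagation) functional
`D_N(t) = ∫ (v_t(z) - v_t(z̃))² d(μ₀ ⊗ ν)` (`z̃` = `z` with `p₀` resampled), the landed reduction
`lightCone_reduction` gives an `N`- and `t`-independent `K = K(T) ≥ 0` with `|P_N(t)| ≤ K √(D_N(t))`.

* `commonPastBudget_of_pointwise` — the abstract transfer: if `|P| ≤ K √D` pointwise, `D ≥ 0`, `P` is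
  measurable and `∫⁻_{(0,t]} D ≤ B` for every finite horizon `t > 0`, then `P² ∈ L¹(0,∞)` with
  `∫₀^∞ P² ≤ K² B` (square the pointwise bound, `lintegral` monotonicity on `(0, n+1]`, and
  `(0,∞) = ⋃ₙ (0, n+1]` as a directed union — `setLIntegral_iUnion_of_directed`).
* `commonPast_sq_integral_le_of_leftBudget` — the registered stub: the left-sensitivity budget
  `∫⁻_{(0,t]} D_N ≤ π²T/(8γ)` (all `N`, `t > 0`) yields the `N`-UNIFORM budget
  `∫₀^∞ P_N(t)² dt ≤ K² · π²T/(8γ)` together with the fixed-`N` integrability of `t ↦ P_N(t)²` on `(0,∞)`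
  (measurability of `t ↦ P_N(t)` is the first conjunct of the landed `stub_commonPastBound`).

No definition, no `sorry`; inputs: the landed theorems named above, the route Defs vocabulary, Mathlib.
-/

noncomputable section

namespace Summit.AtomisticToContinuum.FouriersLaw.Theorems.PhononMeanFreePath

open MeasureTheory Set Filter Topology ProbabilityTheory
open scoped NNReal ENNReal
open Literature.MathematicalPhysics.KineticTheory.HeatConduction

/-- `a² ≤ K² D` from `|a| ≤ K √D` (`D ≥ 0`). [folklore] -/
theorem commonPastBudget_sq_le_of_abs_le {a K D : ℝ} (h : |a| ≤ K * Real.sqrt D) (hD : 0 ≤ D) :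
    a ^ 2 ≤ K ^ 2 * D := by
  calc a ^ 2 = |a| ^ 2 := (sq_abs a).symm
    _ ≤ (K * Real.sqrt D) ^ 2 := pow_le_pow_left₀ (abs_nonneg a) h 2
    _ = K ^ 2 * D := by rw [mul_pow, Real.sq_sqrt hD]

/-- `(0,∞)` is the increasing union of the finite horizons `(0, n+1]`, `n ∈ ℕ`. [folklore] -/
theorem commonPastBudget_iUnion_Ioc_nat_succ : (⋃ n : ℕ, Ioc (0 : ℝ) ((n : ℝ) + 1)) = Ioi 0 :=
  iUnion_Ioc_eq_Ioi_self_iff.2 fun x _ =>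
    (exists_nat_ge x).imp fun _ hn => hn.trans (le_add_of_nonneg_right zero_le_one)

/-- **Abstract budget transfer.** If `P : ℝ → ℝ` is measurable, `|P s| ≤ K √(D s)` and `0 ≤ D s` for
every `s`, and the finite-horizon budgets `∫⁻_{(0,t]} D ≤ B` hold for every `t > 0` (`B ≥ 0`), then
`s ↦ P(s)²` is integrable on `(0,∞)` and `∫₀^∞ P² ≤ K² B`. [folklore] -/
theorem commonPastBudget_of_pointwise {P D : ℝ → ℝ} {K B : ℝ} (hPm : Measurable P) (hB : 0 ≤ B)
    (hPD : ∀ s, |P s| ≤ K * Real.sqrt (D s)) (hD0 : ∀ s, 0 ≤ D s)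
    (hbud : ∀ t : ℝ, 0 < t → ∫⁻ s in Ioc (0 : ℝ) t, ENNReal.ofReal (D s) ≤ ENNReal.ofReal B) :
    IntegrableOn (fun s => P s ^ 2) (Ioi (0 : ℝ)) ∧ ∫ s in Ioi (0 : ℝ), P s ^ 2 ≤ K ^ 2 * B := by
  -- the pointwise bound, in `ℝ≥0∞`
  have hpt : ∀ s, ENNReal.ofReal (P s ^ 2) ≤ ENNReal.ofReal (K ^ 2) * ENNReal.ofReal (D s) := fun s => by
    rw [← ENNReal.ofReal_mul (sq_nonneg K)]
    exact ENNReal.ofReal_le_ofReal (commonPastBudget_sq_le_of_abs_le (hPD s) (hD0 s))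
  -- finite horizons
  have hIoc : ∀ t : ℝ, 0 < t →
      ∫⁻ s in Ioc (0 : ℝ) t, ENNReal.ofReal (P s ^ 2) ≤ ENNReal.ofReal (K ^ 2 * B) := by
    intro t ht
    calc ∫⁻ s in Ioc (0 : ℝ) t, ENNReal.ofReal (P s ^ 2)
        ≤ ∫⁻ s in Ioc (0 : ℝ) t, ENNReal.ofReal (K ^ 2) * ENNReal.ofReal (D s) := lintegral_mono fun s => hpt s
      _ = ENNReal.ofReal (K ^ 2) * ∫⁻ s in Ioc (0 : ℝ) t, ENNReal.ofReal (D s) :=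
          lintegral_const_mul' _ _ ENNReal.ofReal_ne_top
      _ ≤ ENNReal.ofReal (K ^ 2) * ENNReal.ofReal B := mul_le_mul_right (hbud t ht) _
      _ = ENNReal.ofReal (K ^ 2 * B) := (ENNReal.ofReal_mul (sq_nonneg K)).symm
  -- the half-line as a directed union of finite horizons (no measurability needed)
  have hdir : Directed (· ⊆ ·) fun n : ℕ => Ioc (0 : ℝ) ((n : ℝ) + 1) :=
    directed_of_isDirected_le fun m n hmn => Ioc_subset_Ioc_right (add_le_add_left (Nat.cast_le.mpr hmn) 1)
  have hIoi : ∫⁻ s in Ioi (0 : ℝ), ENNReal.ofReal (P s ^ 2) ≤ ENNReal.ofReal (K ^ 2 * B) := by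
    rw [← commonPastBudget_iUnion_Ioc_nat_succ, setLIntegral_iUnion_of_directed _ hdir]
    exact iSup_le fun n => hIoc _ (by positivity)
  have h0 : 0 ≤ᵐ[volume.restrict (Ioi (0 : ℝ))] fun s => P s ^ 2 := Eventually.of_forall fun s => sq_nonneg (P s)
  have hInt : IntegrableOn (fun s => P s ^ 2) (Ioi (0 : ℝ)) :=
    ⟨(hPm.pow_const 2).aestronglyMeasurable,
      (hasFiniteIntegral_iff_ofReal h0).2 (hIoi.trans_lt ENNReal.ofReal_lt_top)⟩
  refine ⟨hInt, ?_⟩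
  rw [integral_eq_lintegral_of_nonneg_ae h0 hInt.aestronglyMeasurable]
  exact ENNReal.toReal_le_of_le_ofReal (mul_nonneg (sq_nonneg K) hB) hIoi

/-- **Stub `commonPast_sq_integral_le_of_leftBudget` (the `N`-uniform `L²(dt)` budget of the common-past
term).** If the left-sensitivity functional `D_N(s) = ∫ (v_s(z) - v_s(z̃))² d(μ₀ ⊗ N(0,T))` of the mean
forecast `v_s = fcast` obeys the finite-horizon budget `∫⁻_{(0,t]} D_N ≤ π²T/(8γ)` for all `N` and `t > 0`,
then at every admissible parameter point there is an `N`-INDEPENDENT `C` (namely `K(T)² · π²T/(8γ)` with the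
constant `K(T)` of `lightCone_reduction`, `|P_N(s)| ≤ K √(D_N(s))`) such that for every `N` the map
`s ↦ P_N(s)²` is integrable on `(0,∞)` and `∫₀^∞ P_N(s)² ds ≤ C`. [folklore] -/
theorem commonPast_sq_integral_le_of_leftBudget : (∀ ω₂ lam β γ : ℝ, 0 < ω₂ → 0 ≤ lam → 0 < β → 0 < γ → ∀ T : ℝ, 0 < T → ∀ (N : ℕ) (t : ℝ), 0 < t → ∫⁻ s in Ioc (0 : ℝ) t, ENNReal.ofReal (∫ x : PhaseSpace (N + 1) × ℝ, (fcast ω₂ lam β γ T N s x.1 - fcast ω₂ lam β γ T N s ((x.1.1, Function.update x.1.2 0 x.2) : PhaseSpace (N + 1))) ^ 2 ∂(((pinnedChain ω₂ lam β γ).gibbsMeasure (N + 1) T).prod (ProbabilityTheory.gaussianReal 0 T.toNNReal))) ≤ ENNReal.ofReal (Real.pi ^ 2 * T / (8 * γ))) → ∀ ω₂ lam β γ : ℝ, 0 < ω₂ → 0 < lam → 0 < β → 0 < γ → ∀ T : ℝ, 0 < T → ∃ C : ℝ, ∀ N : ℕ, IntegrableOn (fun s => (commonPast ω₂ lam β γ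 T N s) ^ 2) (Ioi (0 : ℝ)) ∧ ∫ s in Ioi (0 : ℝ), (commonPast ω₂ lam β γ T N s) ^ 2 ≤ C := by
  intro hbud ω₂ lam β γ hω hl hβ hγ T hT
  -- the `N`-independent constant of the light-cone reduction, obtained ONCE
  obtain ⟨K, -, hK⟩ := lightCone_reduction ω₂ lam β γ hω hl.le hβ.le hγ.le T hT
  refine ⟨K ^ 2 * (Real.pi ^ 2 * T / (8 * γ)), fun N => ?_⟩
  exact commonPastBudget_of_pointwise ((stub_commonPastBound ω₂ lam β γ hω hl hβ hγ T hT).1 N).1 (by positivity)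
    (fun s => (hK N s).2) (fun s => integral_nonneg fun x => sq_nonneg _)
    (fun t ht => hbud ω₂ lam β γ hω hl.le hβ hγ T hT N t ht)

end Summit.AtomisticToContinuum.FouriersLaw.Theorems.PhononMeanFreePath

end
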